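import Literature.AlgebraicGeometry.Motives.HodgeThetaSubalgebraUnitaryCoprimeCore
import HarnessLib

/-!
# The idempotent of a full-rank raising/lowering pair at multiplicities `(a, a + r)`: a projector of rank `r` inside the
# `Θ`-subalgebra (Ribet 1983 Thm. 3 beyond coprime multiplicities — first brick of the `(2,4)` complex core; Moonen–Zarhin 1999
# (2.3)–(2.4))

Topic `Literature/AlgebraicGeometry/Motives` (pure complex linear algebra; no geometry).  Theorems only (no definition, no named
fact; D-0026).  Written for the cell `pub-hodgeav-hg6` (req-37 (A) row 2, TABLE X row 8-`(4,2)`: simple abelian SIXFOLDS with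
`End⁰ = k` imaginary quadratic acting with multiplicities `(4,2)`; brick U2a of the `(4,2)` programme, lead g2 2026-08-28T21:14:20Z /
21:16:44Z; honest framing of that cell: HC / HC_AV / HC_CM / H2 NOT proved — THIS file is unconditional linear algebra and
discharges no hypothesis of the cell's cover).

SETTING (as in `HodgeThetaSubalgebraUnitaryCoprimeCore` §2).  `W` a finite-dimensional complex vector space, `𝔊 ⊆ End(W)` a
`ℂ`-subspace closed under the commutator with `1, Θ ∈ 𝔊`, `Θ² = 1`, `P = {Θ = 1}`, `Q = {Θ = −1}`; a raising `B ∈ 𝔊`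
(`ΘB = B = −BΘ`), a lowering `C ∈ 𝔊` (`ΘC = −C = −CΘ`) with `BC` injective on `P` (a FULL-RANK PAIR).

* **`UnitaryThetaCore.exists_idempotent_of_fullRank_pair`** — if `dim Q = dim P + r` then `𝔊` contains an IDEMPOTENT `E`
  (`E² = E`) vanishing on `P`, with values in `K := Q ∩ ker(CB)`, equal to the identity on `K`, and `dim range E = r`.  It is
  the element `E = δ⁻¹χ(CB) − ½(1 + Θ)` of the coprime core (`χ` the characteristic polynomial of `BC|_P`, `δ = χ(0) ≠ 0`),
  whose proof (`UnitaryThetaCore.exists_rankOne_idempotent`, the case `r = 1`) is followed VERBATIM up to the final count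
  `dim K = dim Q − dim C(P) = r`.
WHY (the `(2,4)` programme, `r = 2`): in the irreducible `(4,2)` SKELETON `ℂ ⊕ 𝔰𝔩₂⊗1 ⊕ 1⊗𝔰𝔩₃` on `ℂ² ⊗ ℂ³` (grading
`T = 1 ⊗ diag(1,1,−1)`, `P = ℂ² ⊗ e₃` of dimension `2`, `Q = ℂ² ⊗ ⟨e₁, e₂⟩` of dimension `4`) the full-rank pairs are
`1 ⊗ (rank-one maps)` and the idempotents `E_{B,C}` are the rank-TWO projectors onto the «ruling planes» `K = ℂ² ⊗ ℓ`,
`ℓ ⊂ ⟨e₁, e₂⟩` a line; in `End(W)` itself they exhaust all rank-two projectors onto planes of `Q`.  The dichotomy «two such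
planes meet in a line (⟹ a rank-one idempotent, ⟹ `𝔊 = End(W)` by `SymplecticThetaSix.eq_top_of_rankOne_idempotent`) or they
form a ruling (⟹ the tensor skeleton, killed arithmetically by `HodgeThetaSubalgebraRadicalKill`)» is the intended sequel (U2).

## References

* [Ribet1983] K. A. Ribet, *Hodge classes on certain types of abelian varieties*, Amer. J. Math. 105 (1983), Thm. 3.
* [Gordon1997] B. B. Gordon, *A survey of the Hodge conjecture for abelian varieties*, Thm. 6.3.3 and pp. 18–19 («it is here
  that the relative primality of `n'` and `n''` is required»).
* [MoonenZarhin1999LowDim] B. Moonen, Yu. Zarhin, Math. Ann. 315 (1999), §2 (2.3)–(2.4).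
* [GoodmanWallachGTM255] R. Goodman, N. Wallach, *Symmetry, Representations, and Invariants*, §4.1.1 (gradings).
-/

noncomputable section

open Module Polynomial

namespace Literature.AlgebraicGeometry.Motives

namespace HodgeStructure

section RankR

variable {W : Type*} [AddCommGroup W] [Module ℂ W]

set_option maxHeartbeats 800000 in
/-- **A full-rank raising/lowering pair at multiplicities `(a, a + r)` produces an idempotent of rank `r` in `𝔊`.**  Let `𝔊 ∋ 1, Θ`
(`Θ² = 1`) be bracket-closed, `P = {Θ = 1}`, `Q = {Θ = −1}` with `dim Q = dim P + r`, `B ∈ 𝔊` raising, `C ∈ 𝔊` lowering, and `BC`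
injective on `P`.  Then there is `E ∈ 𝔊` with `E² = E`, `E|_P = 0`, `E(W) ⊆ Q ∩ ker(CB)`, `E = id` on `Q ∩ ker(CB)`, and
`dim range E = r` (`E = δ⁻¹χ(CB) − ½(1+Θ)`; `Q = (Q ∩ ker CB) ⊕ C(P)`, `dim C(P) = dim P`).  The case `r = 1` is the tree's
`UnitaryThetaCore.exists_rankOne_idempotent` (same proof). [cite: Ribet1983, Thm. 3] [cite: Gordon1997, Thm. 6.3.3 and pp. 18–19]
[cite: MoonenZarhin1999LowDim, §2 (2.4)] [cite: GoodmanWallachGTM255, §4.1.1] -/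
theorem UnitaryThetaCore.exists_idempotent_of_fullRank_pair [FiniteDimensional ℂ W] {𝔊 : Submodule ℂ (Module.End ℂ W)}
    (hbr : ∀ Y ∈ 𝔊, ∀ Z ∈ 𝔊, Y * Z - Z * Y ∈ 𝔊) (h1 : (1 : Module.End ℂ W) ∈ 𝔊)
    {Θ : Module.End ℂ W} (hΘ : Θ ∈ 𝔊) (hΘΘ : Θ * Θ = 1)
    {P Q : Submodule ℂ W} (hP : ∀ x, x ∈ P ↔ Θ x = x) (hQ : ∀ x, x ∈ Q ↔ Θ x = -x)
    {r : ℕ} (hPQ : Module.finrank ℂ Q = Module.finrank ℂ P + r)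
    {B C : Module.End ℂ W} (hB : B ∈ 𝔊) (hC : C ∈ 𝔊) (hΘB : Θ * B = B) (hBΘ : B * Θ = -B)
    (hΘC : Θ * C = -C) (hCΘ : C * Θ = C) (hinj : ∀ p ∈ P, B (C p) = 0 → p = 0) :
    ∃ E ∈ 𝔊, E * E = E ∧ (∀ p ∈ P, E p = 0) ∧ (∀ w, E w ∈ Q) ∧ (∀ w, C (B (E w)) = 0) ∧
      (∀ u ∈ Q, C (B u) = 0 → E u = u) ∧ Module.finrank ℂ (LinearMap.range E) = r := by
  classical
  -- pointwise facts
  have hΘΘv : ∀ v, Θ (Θ v) = v := fun v => by rw [← Module.End.mul_apply, hΘΘ, Module.End.one_apply]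
  have hBB : B * B = 0 := UnitaryThetaCore.mul_self_eq_zero_of_raise hΘB hBΘ
  have hBP : ∀ p ∈ P, B p = 0 := fun p hp => by
    have h : B p = -(B p) := by
      conv_lhs => rw [← (hP p).1 hp]
      rw [← Module.End.mul_apply, hBΘ, LinearMap.neg_apply]
    have h2 : (2 : ℂ) • B p = 0 := by rw [two_smul]; nth_rewrite 2 [h]; rw [add_neg_cancel]
    exact (smul_eq_zero.1 h2).resolve_left two_ne_zero
  have hCQ : ∀ q ∈ Q, C q = 0 := fun q hq => by
    have h : C q = -(C q) := by
      conv_lhs => rw [← neg_neg q, ← (hQ q).1 hq, map_neg, ← Module.End.mul_apply, hCΘ]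
    have h2 : (2 : ℂ) • C q = 0 := by rw [two_smul]; nth_rewrite 2 [h]; rw [add_neg_cancel]
    exact (smul_eq_zero.1 h2).resolve_left two_ne_zero
  have hBmem : ∀ w, B w ∈ P := fun w => (hP _).2 (by rw [← Module.End.mul_apply, hΘB])
  have hCmem : ∀ w, C w ∈ Q := fun w => (hQ _).2 (by rw [← Module.End.mul_apply, hΘC, LinearMap.neg_apply])
  -- the decomposition `w = P̂ w + Q̂ w`
  have hPhat : ∀ w, (2 : ℂ)⁻¹ • (w + Θ w) ∈ P := fun w =>
    (hP _).2 (by rw [map_smul, map_add, hΘΘv, add_comm])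
  have hQhat : ∀ w, (2 : ℂ)⁻¹ • (w - Θ w) ∈ Q := fun w =>
    (hQ _).2 (by rw [map_smul, map_sub, hΘΘv, ← smul_neg, neg_sub])
  have hsplit : ∀ w, (2 : ℂ)⁻¹ • (w + Θ w) + (2 : ℂ)⁻¹ • (w - Θ w) = w := fun w => by module
  -- the restricted operator `f = BC|_P`, its characteristic polynomial
  have hf : ∀ x ∈ P, (B * C) x ∈ P := fun x _ => hBmem _
  set f : Module.End ℂ P := (B * C).restrict hf with hfdef
  have hfinj : Function.Injective f := by
    intro x y hxy
    apply Subtype.ext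
    have h : ((f x : P) : W) = (f y : W) := by rw [hxy]
    rw [hfdef, LinearMap.coe_restrict_apply, LinearMap.coe_restrict_apply, Module.End.mul_apply,
      Module.End.mul_apply, ← sub_eq_zero, ← map_sub, ← map_sub] at h
    exact sub_eq_zero.1 (hinj _ (Submodule.sub_mem _ x.2 y.2) h)
  have hfunit : IsUnit f := (LinearMap.isUnit_iff_ker_eq_bot f).2 (LinearMap.ker_eq_bot.2 hfinj)
  set χ : ℂ[X] := f.charpoly with hχdef
  set δ : ℂ := χ.coeff 0 with hδdef
  have hδ : δ ≠ 0 := by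
    intro h0
    have hdet : LinearMap.det f = 0 := by
      rw [LinearMap.det_eq_sign_charpoly_coeff, ← hχdef, ← hδdef, h0, mul_zero]
    have hu := (LinearMap.isUnit_iff_isUnit_det f).1 hfunit
    rw [hdet] at hu
    exact not_isUnit_zero hu
  -- Cayley–Hamilton on `P`
  have hCH : ∀ p ∈ P, aeval (B * C) χ p = 0 := fun p hp => by
    have h := UnitaryThetaCore.aeval_restrict_coe hf χ ⟨p, hp⟩
    rw [hχdef, LinearMap.aeval_self_charpoly, LinearMap.zero_apply, Submodule.coe_zero] at h
    rw [hχdef, ← h]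
  -- `χ(BC) = δ · Q̂` on `W`
  have hBCQ : ∀ q ∈ Q, (B * C) q = 0 := fun q hq => by rw [Module.End.mul_apply, hCQ q hq, map_zero]
  have hCBP : ∀ p ∈ P, (C * B) p = 0 := fun p hp => by rw [Module.End.mul_apply, hBP p hp, map_zero]
  have haevalBC : aeval (B * C) χ = δ • ((2 : ℂ)⁻¹ • ((1 : Module.End ℂ W) - Θ)) := by
    refine LinearMap.ext fun w => ?_
    conv_lhs => rw [← hsplit w]
    rw [map_add, hCH _ (hPhat w), zero_add, UnitaryThetaCore.aeval_apply_of_apply_eq_zero _ _ (hBCQ _ (hQhat w))]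
    simp only [LinearMap.smul_apply, LinearMap.sub_apply, Module.End.one_apply, hδdef]
  have haevalBCmem : aeval (B * C) χ ∈ 𝔊 := by
    rw [haevalBC]
    exact Submodule.smul_mem _ _ (Submodule.smul_mem _ _ (Submodule.sub_mem _ h1 hΘ))
  have haevalCBmem : aeval (C * B) χ ∈ 𝔊 := by
    have h := Submodule.sub_mem _ haevalBCmem (UnitaryThetaCore.aeval_sub_aeval_mem hbr hB hC hBB χ)
    rwa [sub_sub_cancel] at h
  -- the element `E`
  set E : Module.End ℂ W := δ⁻¹ • aeval (C * B) χ - (2 : ℂ)⁻¹ • (1 + Θ) with hEdef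
  have hEmem : E ∈ 𝔊 :=
    Submodule.sub_mem _ (Submodule.smul_mem _ _ haevalCBmem) (Submodule.smul_mem _ _ (Submodule.add_mem _ h1 hΘ))
  have hEP : ∀ p ∈ P, E p = 0 := fun p hp => by
    rw [hEdef, LinearMap.sub_apply, LinearMap.smul_apply,
      UnitaryThetaCore.aeval_apply_of_apply_eq_zero _ _ (hCBP p hp), ← hδdef, smul_smul, inv_mul_cancel₀ hδ,
      one_smul, LinearMap.smul_apply, LinearMap.add_apply, Module.End.one_apply, (hP p).1 hp]
    module
  have hEQ : ∀ q ∈ Q, E q = δ⁻¹ • aeval (C * B) χ q := fun q hq => by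
    rw [hEdef, LinearMap.sub_apply, LinearMap.smul_apply, LinearMap.smul_apply, LinearMap.add_apply,
      Module.End.one_apply, (hQ q).1 hq, add_neg_cancel, smul_zero, sub_zero]
  -- `K = Q ∩ ker(CB)`; `E` maps `W` into `K` and is the identity on `K`
  set K : Submodule ℂ W := Q ⊓ LinearMap.ker (C * B) with hKdef
  have hΘCB : Θ * (C * B) = C * B * Θ := by
    rw [← mul_assoc, hΘC, mul_assoc, hBΘ, neg_mul, mul_neg]
  have hEQmem : ∀ q ∈ Q, E q ∈ K := fun q hq => by
    rw [hEQ q hq]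
    refine Submodule.smul_mem _ _ (Submodule.mem_inf.2 ⟨(hQ _).2 ?_, LinearMap.mem_ker.2 ?_⟩)
    · rw [← Module.End.mul_apply, UnitaryThetaCore.commute_aeval hΘCB, Module.End.mul_apply, (hQ q).1 hq, map_neg]
    · rw [← Module.End.mul_apply, UnitaryThetaCore.mul_aeval_eq, Module.End.mul_apply,
        Module.End.mul_apply, hCH _ (hBmem q), map_zero]
  have hEW : ∀ w, E w ∈ K := fun w => by
    rw [← hsplit w, map_add, hEP _ (hPhat w), zero_add]
    exact hEQmem _ (hQhat w)
  have hEK : ∀ u ∈ K, E u = u := fun u hu => by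
    have hu' := Submodule.mem_inf.1 hu
    rw [hEQ u hu'.1, UnitaryThetaCore.aeval_apply_of_apply_eq_zero _ _ (LinearMap.mem_ker.1 hu'.2), ← hδdef,
      smul_smul, inv_mul_cancel₀ hδ, one_smul]
  -- `dim K = r`: `Q = K ⊕ C(P)` and `dim C(P) = dim P`
  have hCinj : ∀ p ∈ P, C p = 0 → p = 0 := fun p hp h0 => hinj p hp (by rw [h0, map_zero])
  set g : P →ₗ[ℂ] W := C ∘ₗ P.subtype with hgdef
  have hginj : Function.Injective g := by
    intro x y hxy
    apply Subtype.ext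
    have h : C (x - y : P) = 0 := by
      rw [Submodule.coe_sub, map_sub]; exact sub_eq_zero.2 hxy
    exact sub_eq_zero.1 (by exact_mod_cast hCinj _ (x - y).2 h)
  have hrange : LinearMap.range g = P.map C := by
    rw [hgdef, LinearMap.range_comp, Submodule.range_subtype]
  have hfin_map : Module.finrank ℂ (P.map C) = Module.finrank ℂ P := by
    rw [← hrange, LinearMap.finrank_range_of_inj hginj]
  have hsup : K ⊔ P.map C = Q := by
    apply le_antisymm
    · refine sup_le (fun x hx => hx.1) ?_
      rintro _ ⟨p, -, rfl⟩
      exact hCmem p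
    · intro q hq
      -- `p ∈ P` with `BCp = Bq`
      obtain ⟨p', hp'⟩ := (LinearMap.injective_iff_surjective.1 hfinj) ⟨B q, hBmem q⟩
      have hp'W : B (C (p' : W)) = B q := by
        have h := congrArg Subtype.val hp'
        rw [hfdef, LinearMap.coe_restrict_apply, Module.End.mul_apply] at h
        exact h
      have hsplitq : q = (q - C p') + C p' := by abel
      rw [hsplitq]
      refine Submodule.add_mem _ (Submodule.mem_sup_left (Submodule.mem_inf.2
        ⟨Submodule.sub_mem _ hq (hCmem _), LinearMap.mem_ker.2 ?_⟩)) (Submodule.mem_sup_right ⟨p', p'.2, rfl⟩)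
      rw [Module.End.mul_apply, map_sub, hp'W, sub_self, map_zero]
  have hinf : K ⊓ P.map C = ⊥ := by
    rw [eq_bot_iff]
    rintro x ⟨hxK, ⟨p, hp, rfl⟩⟩
    rw [Submodule.mem_bot]
    have h1' : B (C p) = 0 := by
      have hk : C (B (C p)) = 0 := by
        have h := LinearMap.mem_ker.1 (Submodule.mem_inf.1 hxK).2
        rwa [Module.End.mul_apply] at h
      exact hCinj _ (hBmem _) hk
    rw [hinj p hp h1', map_zero]
  have hdimK : Module.finrank ℂ K = r := by
    have h := Submodule.finrank_sup_add_finrank_inf_eq K (P.map C)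
    rw [hsup, hinf, finrank_bot, add_zero, hfin_map, hPQ] at h
    omega
  -- `range E = K`
  have hrangeE : LinearMap.range E = K := by
    apply le_antisymm
    · rintro _ ⟨w, rfl⟩
      exact hEW w
    · intro u hu
      exact ⟨u, hEK u hu⟩
  refine ⟨E, hEmem, LinearMap.ext fun w => ?_, hEP, fun w => (Submodule.mem_inf.1 (hEW w)).1, fun w => ?_,
    fun u hu hu0 => hEK u (Submodule.mem_inf.2 ⟨hu, LinearMap.mem_ker.2 (by rw [Module.End.mul_apply, hu0])⟩), ?_⟩
  · rw [Module.End.mul_apply, hEK _ (hEW w)]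
  · have h := LinearMap.mem_ker.1 (Submodule.mem_inf.1 (hEW w)).2
    rwa [Module.End.mul_apply] at h
  · rw [hrangeE, hdimK]

end RankR

end HodgeStructure

end Literature.AlgebraicGeometry.Motives

end
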